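import Summits.QuantumFields.BalabanUV.T4Continuum.Support.NE3ShapeCrudeTorus
import Summits.QuantumFields.BalabanUV.T4Continuum.Support.NE3EnergyRateFlatClass
import HarnessLib

/-!
# T⁴ programme, node NE3 — JOINT NON-VACUITY OF THE CAPSTONE `ne3Shape_thm1Type_crude` OVER ONE CLASS FAMILY:
# `NE3Shape` BY NAME, HYPOTHESIS-FREE, for the flat datum over the genuine small-field class `sfClass 4 L N ε`

NE3 formalisation swarm `b2b-balaban-t4-ne3-formalise-*`, LEAF PROVER 04 (unit `b2b-balaban-t4-ne3-formalise-leaf-04`,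
gen 3), support node «A-NV-joint» of `t4/formal/NE3/LEAVES.md` (typer ρ59), file 2∕2; INTENT journal l.11416.

The owner's capstone `NE3ShapeCrudeTorus.ne3Shape_thm1Type_crude` (p215418) concludes `T4EtaRateMin.NE3Shape … (L⁻¹)` from
(H∃) in choice form ∧ the regime (five thresholds + class radius) ∧ P2's ROOT T-E, over a class family `𝒞 ⊇ sfClass ε`.
Its HONEST line records that the two halves were witnessed on DIFFERENT class families (`actionRate_thm1Type_flat` on
`sfClass ε`, `ne3EnergyRate_flat` on the singleton `flatClass`, which `hsub` excludes).  File 1∕2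
(`NE3EnergyRateFlatClass.ne3EnergyRate_sfClass_flat`) supplies T-E for the flat datum OVER `sfClass ε` ITSELF; this file
instantiates the capstone there, so that ALL its hypotheses are discharged at once on ONE class family:
* `ne3Shape_crude_sfClass_flat_of_regime`: for every `L ≥ 2`, `N ≥ 1`, `C ≥ 0` and every regime point `t ≥ 0` obeying the
  capstone's six displayed inequalities (class radius `ε`), `NE3Shape (minActReadings 4 (sfClass 4 L N ε) L N {flatCfg} loc_D)
  (max C_A K_D(t,t,C)) (L⁻¹)` — (H∃) by `isMinimiser_sfClass_flatCfg` + `regularSup_flatCfg` (b = c = t), T-E by file 1.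
* `ne3Shape_crude_sfClass_flat`: the corner `b = c = t = 0` (every `ε ≥ 0`): `NE3Shape (…) (max C_A 0) (L⁻¹)`, NO arithmetic.
* `ne3Shape_crude_sfClass_flat_numeric`: `L = 2`, `t = 10⁻⁴⁰`, `ε = 1`, every `N ≥ 1`, `C ≥ 0` — the six inequalities
  DISCHARGED by `norm_num` (`gradRem 4 = 3588`), i.e. the regime with `t > 0` is inhabited: nothing in the capstone is vacuous.

USAGE NOTE (XREAD DOCFIX-1 on p215418, journal l.11519): the capstone's signature carries the implicit binder `{dom}` twice;
the first copy is vacuous and not inferable, so `dom` is passed BY NAME as `(dom := {flatCfg})` — a spelling that elaborates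
both against the landed v1 (it fills the vacuous copy; the real one is inferred from `hTE`) and against a v1.1 with the
duplicate removed (it then is the real one).

HONEST FRAMING.  A NON-VACUITY result: the capstone's hypothesis set is jointly satisfiable over ONE class family (the one
route (A) uses), at the FLAT datum, where every constrained minimiser is a periodic pure gauge and both rates are trivially
`0 ≤ C θ^k`.  It says NOTHING about Bałaban's minimisers at a non-flat datum: NE3 is NOT proved; (H∃) ([Balaban1985Variational]
Thm 1 TYPE) and T-E (`NE3EnergyRate`) remain HYPOTHESES there; `K_D ∝ N⁴` (fixed torus).  No estimate of the cell is touched; no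
conditional of the cell (`BetaPertH`, (B), (B^μ), G-an2-4) is used or hidden; nothing printed is a hypothesis of a theorem; no
`def`, no `sorry`, axioms ⊆ {propext, Classical.choice, Quot.sound}.  Finite T⁴ rung (B)+1 — NOT infinite volume, NOT a mass
gap, NOT the Clay problem, NOT summit progress.  PLACEMENT: `Summits/QuantumFields/BalabanUV/`.  HONEST DEPENDENCY (cell
page 1): continuum YM on T⁴ ⇐ BetaPertH ∧ nine spine estimates (0/9 proved); BetaPertH ⇐ (D1) ∧ (D4) ∧ CAP+tail; G-an2-4
gates asym, D1 and NE2/3/4.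
-/

set_option autoImplicit false

open scoped BigOperators Matrix Matrix.Norms.L2Operator
open NormedSpace Finset

namespace Summit.QuantumFields.BalabanUV.T4Continuum.NE3ShapeCrudeWitness

open Literature.MathematicalPhysics.QuantumFieldTheory.Balaban1983to89
open B7Prop1Explicit B7Prop2Explicit
open T4AveragingDeficitWall hiding Site Plane Plaq Bond
open T4AveragingDeficitWallBoundary (periodBox)
open T4AveragingDeficitNonAbelian (wallConstNA wallConstNA_nonneg wallConstLoc)
open T4EtaRateMin (NE3Shape)
open AveragingDeficitDualResidual (dualC1 dualC2)
open AveragingDeficitDerivWallProof (wallConst)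
open MinimalActionSandwich MinimalActionRate MinimalActionRefine
open MinimalActionWitness (flatCfg isMinimiser_sfClass_flatCfg)
open SkeletonPrecompGrad (gradRem)
open NE3EnergyShapes (NE3EnergyRate)
open NE3ShapeCrudeTorus (ne3Shape_thm1Type_crude)
open NE3EnergyRateFlatClass (ne3EnergyRate_sfClass_flat)

noncomputable section

variable {n : Type*} [Fintype n] [DecidableEq n] [Nonempty n]

/-- **THE CAPSTONE ON ONE CLASS FAMILY, EVERY REGIME POINT**: `L ≥ 2`, `N ≥ 1`, `0 ≤ t`, `0 ≤ C`, the capstone's five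
thresholds `Tᵢ(4,L)·t ≤ 1` and its class-radius condition `18(K_b+K_m)L⁶t ≤ ε` ⇒
`NE3Shape (minActReadings 4 (sfClass 4 L N ε) L N {flatCfg} loc_D) (max C_A K_D) (L⁻¹)` with `b = c = t`, where (H∃) is
DISCHARGED by the flat configuration (`isMinimiser_sfClass_flatCfg`, `regularSup_flatCfg`) and T-E by
`NE3EnergyRateFlatClass.ne3EnergyRate_sfClass_flat` — all hypotheses of `ne3Shape_thm1Type_crude` inhabited on the SAME
`𝒞 = sfClass 4 L N ε`, `dom = {flatCfg}`.  Non-vacuity only; NE3 NOT proved. [folklore] -/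
theorem ne3Shape_crude_sfClass_flat_of_regime {L N : ℕ} (hL : 2 ≤ L) (hN : 1 ≤ N) {t ε C : ℝ} (ht : 0 ≤ t) (hC : 0 ≤ C)
    (hT1 : (160 * (4 : ℕ) + 168 * ((4 : ℕ) : ℝ) ^ 2
        + 2 * (32 * (4 : ℕ) + (24 * (4 : ℕ) * (2 * ((4 : ℕ) : ℝ) + gradRem 4)
          + 14336 * ((4 : ℕ) : ℝ) ^ 2 * (((4 : ℕ) : ℝ) + 1) ^ 2) + 12 * (2 * ((4 : ℕ) : ℝ) + gradRem 4))
        + 512 * (((4 : ℕ) : ℝ) + 1) * (((4 : ℕ) : ℝ) + 4) * (L : ℝ) ^ 2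
          * (32 * (4 : ℕ) + 48 * (4 : ℕ) * (L : ℝ) ^ 2 * (2 * ((4 : ℕ) : ℝ) + gradRem 4)
            + 8192 * ((4 : ℕ) : ℝ) ^ 2 * (2 * ((4 : ℕ) : ℝ) + 1) ^ 2 * (L : ℝ) ^ 2)) * t ≤ 1)
    (hT2 : 2 ^ 15 * (((4 : ℕ) : ℝ) + 1) ^ 2 * (((4 : ℕ) : ℝ) + 4) ^ 2 * (L : ℝ) ^ 2 * t ≤ 1)
    (hT3 : 2 ^ 14 * (((4 : ℕ) : ℝ) + 1) * (((4 : ℕ) : ℝ) + 4) * (L : ℝ) ^ (2 * (4 : ℕ) + 3)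
          * ((32 * (4 : ℕ) + 48 * (4 : ℕ) * (L : ℝ) ^ 2 * (2 * ((4 : ℕ) : ℝ) + gradRem 4)
              + 8192 * ((4 : ℕ) : ℝ) ^ 2 * (2 * ((4 : ℕ) : ℝ) + 1) ^ 2 * (L : ℝ) ^ 2)
            + (3 * (1280 * (4 : ℕ) * (((4 : ℕ) : ℝ) + 1) ^ 2 * (((4 : ℕ) : ℝ) + 4) ^ 2 * (L : ℝ) ^ 2
            * (32 * (4 : ℕ) + 48 * (4 : ℕ) * (L : ℝ) ^ 2 * (2 * ((4 : ℕ) : ℝ) + gradRem 4)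
              + 8192 * ((4 : ℕ) : ℝ) ^ 2 * (2 * ((4 : ℕ) : ℝ) + 1) ^ 2 * (L : ℝ) ^ 2) ^ 2
          + (4 : ℕ) * (((4 : ℕ) : ℝ) + 1) * ((L : ℝ) ^ 3 * (256 * ((4 : ℕ) : ℝ) ^ 2
              * (32 * (4 : ℕ) + (24 * (4 : ℕ) * (2 * ((4 : ℕ) : ℝ) + gradRem 4)
                + 14336 * ((4 : ℕ) : ℝ) ^ 2 * (((4 : ℕ) : ℝ) + 1) ^ 2) + 12 * (2 * ((4 : ℕ) : ℝ) + gradRem 4))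
            + 4 * (24 * (4 : ℕ) * (2 * ((4 : ℕ) : ℝ) + gradRem 4) + 14336 * ((4 : ℕ) : ℝ) ^ 2 * (((4 : ℕ) : ℝ) + 1) ^ 2)
            + 24 * (2 * ((4 : ℕ) : ℝ) + gradRem 4)))
          + (((4 : ℕ) : ℝ) - 1) ^ 2 * (37 * (((4 : ℕ) : ℝ) - 1) + 5)))) * t ≤ 1)
    (hT4 : ((32 * (4 : ℕ) + 48 * (4 : ℕ) * (L : ℝ) ^ 2 * (2 * ((4 : ℕ) : ℝ) + gradRem 4)
              + 8192 * ((4 : ℕ) : ℝ) ^ 2 * (2 * ((4 : ℕ) : ℝ) + 1) ^ 2 * (L : ℝ) ^ 2)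
            + 8 * (3 * (1280 * (4 : ℕ) * (((4 : ℕ) : ℝ) + 1) ^ 2 * (((4 : ℕ) : ℝ) + 4) ^ 2 * (L : ℝ) ^ 2
            * (32 * (4 : ℕ) + 48 * (4 : ℕ) * (L : ℝ) ^ 2 * (2 * ((4 : ℕ) : ℝ) + gradRem 4)
              + 8192 * ((4 : ℕ) : ℝ) ^ 2 * (2 * ((4 : ℕ) : ℝ) + 1) ^ 2 * (L : ℝ) ^ 2) ^ 2
          + (4 : ℕ) * (((4 : ℕ) : ℝ) + 1) * ((L : ℝ) ^ 3 * (256 * ((4 : ℕ) : ℝ) ^ 2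
              * (32 * (4 : ℕ) + (24 * (4 : ℕ) * (2 * ((4 : ℕ) : ℝ) + gradRem 4)
                + 14336 * ((4 : ℕ) : ℝ) ^ 2 * (((4 : ℕ) : ℝ) + 1) ^ 2) + 12 * (2 * ((4 : ℕ) : ℝ) + gradRem 4))
            + 4 * (24 * (4 : ℕ) * (2 * ((4 : ℕ) : ℝ) + gradRem 4) + 14336 * ((4 : ℕ) : ℝ) ^ 2 * (((4 : ℕ) : ℝ) + 1) ^ 2)
            + 24 * (2 * ((4 : ℕ) : ℝ) + gradRem 4)))
          + (((4 : ℕ) : ℝ) - 1) ^ 2 * (37 * (((4 : ℕ) : ℝ) - 1) + 5))) * (L : ℝ) ^ ((4 : ℕ) + 2)) * t ≤ 1)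
    (hT5 : (((L : ℝ) ^ 3 * (256 * ((4 : ℕ) : ℝ) ^ 2
              * (32 * (4 : ℕ) + (24 * (4 : ℕ) * (2 * ((4 : ℕ) : ℝ) + gradRem 4)
                + 14336 * ((4 : ℕ) : ℝ) ^ 2 * (((4 : ℕ) : ℝ) + 1) ^ 2) + 12 * (2 * ((4 : ℕ) : ℝ) + gradRem 4))
            + 4 * (24 * (4 : ℕ) * (2 * ((4 : ℕ) : ℝ) + gradRem 4) + 14336 * ((4 : ℕ) : ℝ) ^ 2 * (((4 : ℕ) : ℝ) + 1) ^ 2)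
            + 24 * (2 * ((4 : ℕ) : ℝ) + gradRem 4)))
            + 36 * (3 * (1280 * (4 : ℕ) * (((4 : ℕ) : ℝ) + 1) ^ 2 * (((4 : ℕ) : ℝ) + 4) ^ 2 * (L : ℝ) ^ 2
            * (32 * (4 : ℕ) + 48 * (4 : ℕ) * (L : ℝ) ^ 2 * (2 * ((4 : ℕ) : ℝ) + gradRem 4)
              + 8192 * ((4 : ℕ) : ℝ) ^ 2 * (2 * ((4 : ℕ) : ℝ) + 1) ^ 2 * (L : ℝ) ^ 2) ^ 2
          + (4 : ℕ) * (((4 : ℕ) : ℝ) + 1) * ((L : ℝ) ^ 3 * (256 * ((4 : ℕ) : ℝ) ^ 2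
              * (32 * (4 : ℕ) + (24 * (4 : ℕ) * (2 * ((4 : ℕ) : ℝ) + gradRem 4)
                + 14336 * ((4 : ℕ) : ℝ) ^ 2 * (((4 : ℕ) : ℝ) + 1) ^ 2) + 12 * (2 * ((4 : ℕ) : ℝ) + gradRem 4))
            + 4 * (24 * (4 : ℕ) * (2 * ((4 : ℕ) : ℝ) + gradRem 4) + 14336 * ((4 : ℕ) : ℝ) ^ 2 * (((4 : ℕ) : ℝ) + 1) ^ 2)
            + 24 * (2 * ((4 : ℕ) : ℝ) + gradRem 4)))
          + (((4 : ℕ) : ℝ) - 1) ^ 2 * (37 * (((4 : ℕ) : ℝ) - 1) + 5))) * (L : ℝ) ^ ((4 : ℕ) + 2)) * t ≤ 1)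
    (hεt : 18 * ((32 * (4 : ℕ) + 48 * (4 : ℕ) * (L : ℝ) ^ 2 * (2 * ((4 : ℕ) : ℝ) + gradRem 4)
              + 8192 * ((4 : ℕ) : ℝ) ^ 2 * (2 * ((4 : ℕ) : ℝ) + 1) ^ 2 * (L : ℝ) ^ 2)
            + (3 * (1280 * (4 : ℕ) * (((4 : ℕ) : ℝ) + 1) ^ 2 * (((4 : ℕ) : ℝ) + 4) ^ 2 * (L : ℝ) ^ 2
            * (32 * (4 : ℕ) + 48 * (4 : ℕ) * (L : ℝ) ^ 2 * (2 * ((4 : ℕ) : ℝ) + gradRem 4)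
              + 8192 * ((4 : ℕ) : ℝ) ^ 2 * (2 * ((4 : ℕ) : ℝ) + 1) ^ 2 * (L : ℝ) ^ 2) ^ 2
          + (4 : ℕ) * (((4 : ℕ) : ℝ) + 1) * ((L : ℝ) ^ 3 * (256 * ((4 : ℕ) : ℝ) ^ 2
              * (32 * (4 : ℕ) + (24 * (4 : ℕ) * (2 * ((4 : ℕ) : ℝ) + gradRem 4)
                + 14336 * ((4 : ℕ) : ℝ) ^ 2 * (((4 : ℕ) : ℝ) + 1) ^ 2) + 12 * (2 * ((4 : ℕ) : ℝ) + gradRem 4))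
            + 4 * (24 * (4 : ℕ) * (2 * ((4 : ℕ) : ℝ) + gradRem 4) + 14336 * ((4 : ℕ) : ℝ) ^ 2 * (((4 : ℕ) : ℝ) + 1) ^ 2)
            + 24 * (2 * ((4 : ℕ) : ℝ) + gradRem 4)))
          + (((4 : ℕ) : ℝ) - 1) ^ 2 * (37 * (((4 : ℕ) : ℝ) - 1) + 5)))) * (L : ℝ) ^ ((4 : ℕ) + 2) * t ≤ ε) :
    NE3Shape
      (minActReadings 4 (sfClass (n := n) 4 L N ε) L N {flatCfg}
        (fun k (_ : Site 4 → Fin 4 → (Matrix n n ℂ)ˣ) (x : ↥(periodBox (d := 4) N)) =>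
          fineAction (flatCfg : Site 4 → Fin 4 → (Matrix n n ℂ)ˣ) (((blockSites L)^[k] {(x : Site 4)}) ×ˢ Finset.univ)))
      (max (wallConstNA 4 L * (gradConst 4 1 + 1) / (L : ℝ) ^ 2)
        (wallConstLoc 4 L * (2500 * (L : ℝ) ^ 3 * Fintype.card (T4AveragingDeficitWall.Plane 4) * (t * t + t ^ 2) + t ^ 3)
          + ((t + 23142400 * t ^ 2) * Real.sqrt (Fintype.card (T4AveragingDeficitWall.Plane 4))
              * (C * (wallConst 4 L * (N : ℝ) ^ 2 * (Real.sqrt (gradConst 4 t) * dualC2 4 L + 2 * t ^ 2 * dualC1 4 L)))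
            + 14 * Fintype.card (T4AveragingDeficitWall.Plane 4)
              * (C * (wallConst 4 L * (N : ℝ) ^ 2 * (Real.sqrt (gradConst 4 t) * dualC2 4 L + 2 * t ^ 2 * dualC1 4 L))) ^ 2)
        + Fintype.card (T4AveragingDeficitWall.Plane 4) * t ^ 2))
      ((L : ℝ)⁻¹) := by
  have hL1 : 1 ≤ L := le_trans (by norm_num) hL
  have hε : 0 ≤ ε := by
    have h6 : (0 : ℝ) ≤ (L : ℝ) ^ ((4 : ℕ) + 2) := by positivity
    have hΓ : (0 : ℝ) ≤ gradRem 4 := by unfold gradRem; norm_num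
    refine le_trans ?_ hεt
    positivity
  exact ne3Shape_thm1Type_crude (d := 4) (dom := {flatCfg}) rfl hL hN (b := t) (c := t) (t := t) ht ht le_rfl le_rfl hC
    (fun _ => subset_rfl) hT1 hT2 hT3 hT4 hT5 hεt
    (ne3EnergyRate_sfClass_flat (d := 4) hL1 hN hε t (gradConst 4 t) hC)
    (sel := fun _ _ => flatCfg)
    (fun V hV k => by rw [Set.mem_singleton_iff] at hV; subst hV; exact isMinimiser_sfClass_flatCfg hL1 N hε k)
    (fun V hV k => by rw [Set.mem_singleton_iff] at hV; subst hV; exact regularSup_flatCfg L N k ht ht)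

/-- **THE CAPSTONE ON ONE CLASS FAMILY, NO ARITHMETIC**: the corner `b = c = t = 0` of the regime (every `ε ≥ 0`; the
thresholds read `0 ≤ 1`, the class radius `0 ≤ ε`; `gradConst 4 0 = 0` so the crude (D) constant vanishes):
`NE3Shape (minActReadings 4 (sfClass 4 L N ε) L N {flatCfg} loc_D) (max C_A 0) (L⁻¹)` for every `L ≥ 2`, `N ≥ 1`,
HYPOTHESIS-FREE.  Non-vacuity only; NE3 NOT proved. [folklore] -/
theorem ne3Shape_crude_sfClass_flat {L N : ℕ} (hL : 2 ≤ L) (hN : 1 ≤ N) {ε : ℝ} (hε : 0 ≤ ε) :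
    NE3Shape
      (minActReadings 4 (sfClass (n := n) 4 L N ε) L N {flatCfg}
        (fun k (_ : Site 4 → Fin 4 → (Matrix n n ℂ)ˣ) (x : ↥(periodBox (d := 4) N)) =>
          fineAction (flatCfg : Site 4 → Fin 4 → (Matrix n n ℂ)ˣ) (((blockSites L)^[k] {(x : Site 4)}) ×ˢ Finset.univ)))
      (max (wallConstNA 4 L * (gradConst 4 1 + 1) / (L : ℝ) ^ 2) 0)
      ((L : ℝ)⁻¹) := by
  have h := ne3Shape_crude_sfClass_flat_of_regime (n := n) hL hN (t := 0) (ε := ε) (C := 0) le_rfl le_rfl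
    (by rw [mul_zero]; exact zero_le_one) (by rw [mul_zero]; exact zero_le_one) (by rw [mul_zero]; exact zero_le_one)
    (by rw [mul_zero]; exact zero_le_one) (by rw [mul_zero]; exact zero_le_one) (by rw [mul_zero]; exact hε)
  convert h using 3
  simp [MinimalActionRefine.gradConst]

/-- `gradRem 4 = 3588`. [folklore] -/
theorem gradRem_four : gradRem 4 = 3588 := by unfold gradRem; norm_num

/-- **THE REGIME WITH `t > 0` IS INHABITED — A FULLY NUMERIC JOINT INSTANCE**: `L = 2`, `t = 10⁻⁴⁰`, `ε = 1`, every
`N ≥ 1` and every `C ≥ 0`: the capstone's six inequalities are DISCHARGED by `norm_num` (`gradRem 4 = 3588`), so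
`NE3Shape (minActReadings 4 (sfClass 4 2 N 1) 2 N {flatCfg} loc_D) (max C_A K_D(10⁻⁴⁰,10⁻⁴⁰,C)) (2⁻¹)` holds with NO
hypothesis beyond `N ≥ 1`, `C ≥ 0`.  Non-vacuity only; NE3 NOT proved. [folklore] -/
theorem ne3Shape_crude_sfClass_flat_numeric {N : ℕ} (hN : 1 ≤ N) {C : ℝ} (hC : 0 ≤ C) :
    NE3Shape
      (minActReadings 4 (sfClass (n := n) 4 2 N 1) 2 N {flatCfg}
        (fun k (_ : Site 4 → Fin 4 → (Matrix n n ℂ)ˣ) (x : ↥(periodBox (d := 4) N)) =>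
          fineAction (flatCfg : Site 4 → Fin 4 → (Matrix n n ℂ)ˣ) (((blockSites 2)^[k] {(x : Site 4)}) ×ˢ Finset.univ)))
      (max (wallConstNA 4 2 * (gradConst 4 1 + 1) / ((2 : ℕ) : ℝ) ^ 2)
        (wallConstLoc 4 2 * (2500 * ((2 : ℕ) : ℝ) ^ 3 * Fintype.card (T4AveragingDeficitWall.Plane 4)
            * ((1e-40 : ℝ) * 1e-40 + (1e-40 : ℝ) ^ 2) + (1e-40 : ℝ) ^ 3)
          + (((1e-40 : ℝ) + 23142400 * (1e-40 : ℝ) ^ 2) * Real.sqrt (Fintype.card (T4AveragingDeficitWall.Plane 4))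
              * (C * (wallConst 4 2 * (N : ℝ) ^ 2
                * (Real.sqrt (gradConst 4 (1e-40 : ℝ)) * dualC2 4 2 + 2 * (1e-40 : ℝ) ^ 2 * dualC1 4 2)))
            + 14 * Fintype.card (T4AveragingDeficitWall.Plane 4)
              * (C * (wallConst 4 2 * (N : ℝ) ^ 2
                * (Real.sqrt (gradConst 4 (1e-40 : ℝ)) * dualC2 4 2 + 2 * (1e-40 : ℝ) ^ 2 * dualC1 4 2))) ^ 2)
        + Fintype.card (T4AveragingDeficitWall.Plane 4) * (1e-40 : ℝ) ^ 2))
      (((2 : ℕ) : ℝ)⁻¹) :=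
  ne3Shape_crude_sfClass_flat_of_regime (n := n) (L := 2) le_rfl hN (t := 1e-40) (ε := 1) (by norm_num) hC
    (by rw [gradRem_four]; norm_num) (by norm_num) (by rw [gradRem_four]; norm_num) (by rw [gradRem_four]; norm_num)
    (by rw [gradRem_four]; norm_num) (by rw [gradRem_four]; norm_num)

end

end Summit.QuantumFields.BalabanUV.T4Continuum.NE3ShapeCrudeWitness
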